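/-
Origin: expansion seat `planner-pub-hodgecm-pv05-0`, handover 2026-08-18T04:10:59Z (`HOME/pub-hodgecm-pv05/lean/Pv05/GodementBridge.lean`, md5 d7ffb32c, 64 lines);
landed by the gen-5 packager in gate run 21 as `HodgeCM/PerL34/GodementBridge.lean` (verbatim).
-/
/-
pub-hodgecm speedrun cell, prover pv05 — WIP module `Pv05.GodementBridge` (proposed landing place
`HodgeCM/PerL34/GodementBridge.lean`).  Imports: LANDED `HodgeCM.PerL34.Anisotropic` (pv05, run 20) and the Literature
file `HodgeCM.Literature.CohomologicalIsolation` (cf-matsushima-murakami v5b §9b `GodementDatum`, in the tree since the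
run-20 intake).  Nothing posited, nothing cited (the print theorem stays a HYPOTHESIS `Godement_Thm4`).

# BY-NAME seam: PerL v5 ll. 68–69 "`G_U` is anisotropic and `[G_U]` is compact" = PRINT (Godement Thm 4) + KERNEL (pv05)

cf-MM's `GodementDatum` records Godement, Sém. Bourbaki 257 §5 Thm 4 (Borel–Harish-Chandra): "`G_A°/G_k` is compact
iff `G` is anisotropic", where (p0161 L5, verbatim in cf-MM's docstring) "anisotropic" MEANS "no element of `G_k` is
unipotent".  pv05's KERNEL theorem `Doubling.isom_unipotent_trivial` says exactly that for the isometry group of an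
anisotropic (e.g. definite-at-one-place, `anisotropic_of_definite`) hermitian form: every `g ∈ U(h)(L₀)` with `g − 1`
nilpotent is `1`.  This file makes the docstring cross-reference a kernel-checked composition:

* `godementDatum h Q` — the datum of `G = U(W, h)` (`Res_{L₀/ℚ}` understood) with `compactQuotient := Q` (the
  consumer's "[`G`] compact" proposition, e.g. `IsolationCore`'s / `ThetaSide`'s compactness field) and
  `anisotropic := ∀ g : isom h, IsNilpotent (g − 1) → g = 1` (Godement's wording, typed);
* `godementDatum_anisotropic` — that field HOLDS for an anisotropic form (KERNEL, = `isom_unipotent_trivial`);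
* `compact_of_godement` — PRINT hypothesis `(godementDatum h Q).Godement_Thm4` ⇒ `Q`; and `compact_of_definite` — the
  same from definiteness at one place (PerL's `W_i` definite at `ι₁`, `V₃` of signature (3,0) at `ι₂`).
-/
import Summits.HodgeConjecture.HodgeCM.PerL34.Anisotropic
import Summits.HodgeConjecture.HodgeCM.Literature.CohomologicalIsolation_6

/-! PORT of `HodgeCM/PerL34/GodementBridge.lean` (HodgeCMPerL run 82) — verbatim mechanical port; provenance in the PORT header line. -/

set_option autoImplicit false

namespace HodgeCM
namespace PerL34
namespace Doubling

open RallisIP (Anisotropic)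
open HodgeCM.Literature (GodementDatum)

variable {L : Type*} [Field L] [StarRing L] {W : Type*} [AddCommGroup W] [Module L W]

/-- The Godement datum of the unitary group `U(W, h)`: `compactQuotient := Q` (the consumer's compactness
proposition), `anisotropic :=` "no element of `U(h)(L₀)` other than `1` is unipotent" (Sém. Bourbaki 257 §5, p0161 L5). -/
def godementDatum (h : Sesq L W) (Q : Prop) : GodementDatum where
  compactQuotient := Q
  anisotropic := ∀ g : isom h, IsNilpotent (((g : W ≃ₗ[L] W) : W →ₗ[L] W) - 1) → g = 1

/-- (Ported verbatim from the HodgeCMPerL package; no docstring in the source.) -/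
@[simp] theorem godementDatum_compactQuotient (h : Sesq L W) (Q : Prop) :
    (godementDatum h Q).compactQuotient = Q := rfl

/-- **KERNEL:** Godement's anisotropy condition holds for the isometry group of an anisotropic hermitian form. -/
theorem godementDatum_anisotropic (h : Sesq L W) (hh : Anisotropic h) (Q : Prop) :
    (godementDatum h Q).anisotropic :=
  fun g hn => isom_unipotent_trivial h hh g hn

/-- **PRINT + KERNEL ⇒ `[U(h)]` compact:** Godement Thm 4 for this datum (hypothesis) and anisotropy of `h` give the
consumer's compactness proposition `Q`. -/
theorem compact_of_godement (h : Sesq L W) (hh : Anisotropic h) (Q : Prop)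
    (thm4 : (godementDatum h Q).Godement_Thm4) : Q :=
  GodementDatum.compact_of_noUnipotent _ thm4 (godementDatum_anisotropic h hh Q)

/-- The same from definiteness at one place (PerL v5 l. 68: `h` has signature `(3,0)` at `ι₂`; for the lines `W_i`,
l. 381: "`W` is anisotropic, being definite at `ι₁`"): positivity `P` of `h(w,w)` for `w ≠ 0`, failing at `0`. -/
theorem compact_of_definite (h : Sesq L W) (P : L → Prop) (hP0 : ¬ P 0) (hpos : ∀ w : W, w ≠ 0 → P (h w w))
    (Q : Prop) (thm4 : (godementDatum h Q).Godement_Thm4) : Q :=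
  compact_of_godement h (anisotropic_of_definite h P hP0 hpos) Q thm4

end Doubling
end PerL34
end HodgeCM
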